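import Summits.RiemannHypothesis.RiemannHypothesis.Theorems.UniversalFactorLaguerreCriterion
import Literature.Barriers.RiemannHypothesis.NewmanConjecture
import HarnessLib

/-!
# The linear-factor ray of the Laguerre–Pólya deformation class implies RH (cell rh-split, dbn × neg, gen 2)

RAW (zero-definition) typing by seat rh-split-dbn-neg g2 (HOME/rh-split-dbn-neg/LinearRayTwoPointRawA.lean, part 1 of 2;
filed by rh-split-typer-2 after H1 replay, split at the 400-line limit). Every statement is over existing declarations:
the ray `Literature.NumberTheory.LFunctions.HasOnlyRealZeros (Literature.Barriers.RiemannHypothesis.linearFactorH a)`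
(the open residual of `Literature/Barriers/RiemannHypothesis/NewmanConjecture.lean`, «proved or refuted NOWHERE» for
`|a| ≥ π/8`), and `G_a := F_a′ + a·F_a` written out as
`deriv (deBruijnHDiv fun u : ℝ => 1 + u ^ 2 / a ^ 2) z + (a : ℂ) * deBruijnHDiv (fun u : ℝ => 1 + u ^ 2 / a ^ 2) z`
(`linearFactorH a = a⁻¹·G_a`: `linearFactorH_eq_inv_mul_rayG`). Content of this part: basic facts about `G_a`,
Laguerre's inequality on the ray, and **`riemannHypothesis_of_exists_linearRay : (∃ a ≠ 0, ray) → RH`** — the ray is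
an OVER-STRONG (RH-strengthening) conjunct, so refuting it is RH-free bookkeeping; plus the real-variable calculus
for `u := Re G_a` used by part 2 (`Theorems/Splittings/LinearRayTwoPoint.lean`, the two-point certificate).
HONEST LABEL: SPLITTING SEARCH over kernel-typed RH-EQUIVALENCES; refuting the ray is RH-free bookkeeping (the ray is
RH-strengthening); nothing here bears on the truth of RH.
-/

set_option linter.dupNamespace false  -- the mandated namespace repeats `RiemannHypothesis`

noncomputable section

namespace Summit.RiemannHypothesis.RiemannHypothesis.Theorems.Splittings.LinearRayTwoPoint

open Complex Filter Topology MeasureTheory Set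
open Literature.NumberTheory.LFunctions Literature.Analysis.Complex
open Literature.Barriers.RiemannHypothesis (linearFactorH linearFactorH_eq_deBruijnHDiv_add_deriv)
open Summit.RiemannHypothesis.RiemannHypothesis.Theorems

/-! ## Basic facts about `G_a := F_a′ + a·F_a` (written out; this file declares no definitions) -/

/-- `linearFactorH a = a⁻¹ · G_a`. [folklore] -/
theorem linearFactorH_eq_inv_mul_rayG {a : ℝ} (ha : a ≠ 0) (z : ℂ) :
    linearFactorH a z = (a : ℂ)⁻¹ * (deriv (deBruijnHDiv fun u : ℝ => 1 + u ^ 2 / a ^ 2) z + (a : ℂ) * deBruijnHDiv (fun u : ℝ => 1 + u ^ 2 / a ^ 2) z) := by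
  have ha0 : (a : ℂ) ≠ 0 := by exact_mod_cast ha
  rw [linearFactorH_eq_deBruijnHDiv_add_deriv, mul_add, ← mul_assoc, inv_mul_cancel₀ ha0,
    one_mul, add_comm]

/-- `G_a` and `linearFactorH a` have the same zeros (`a ≠ 0`). [folklore] -/
theorem rayG_eq_zero_iff {a : ℝ} (ha : a ≠ 0) (z : ℂ) : (deriv (deBruijnHDiv fun u : ℝ => 1 + u ^ 2 / a ^ 2) z + (a : ℂ) * deBruijnHDiv (fun u : ℝ => 1 + u ^ 2 / a ^ 2) z) = 0 ↔ linearFactorH a z = 0 := by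
  have ha0 : (a : ℂ) ≠ 0 := by exact_mod_cast ha
  rw [linearFactorH_eq_inv_mul_rayG ha, mul_eq_zero, or_iff_right (inv_ne_zero ha0)]

/-- The ray in terms of `G_a`. [folklore] -/
theorem hasOnlyRealZeros_rayG_iff {a : ℝ} (ha : a ≠ 0) :
    (∀ z, (deriv (deBruijnHDiv fun u : ℝ => 1 + u ^ 2 / a ^ 2) z + (a : ℂ) * deBruijnHDiv (fun u : ℝ => 1 + u ^ 2 / a ^ 2) z) = 0 → z.im = 0) ↔ HasOnlyRealZeros (linearFactorH a) := by
  simp only [HasOnlyRealZeros, rayG_eq_zero_iff ha]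

/-- `G_a` is entire. [folklore] -/
theorem differentiable_rayG (a : ℝ) : Differentiable ℂ (fun z : ℂ => deriv (deBruijnHDiv fun u : ℝ => 1 + u ^ 2 / a ^ 2) z + (a : ℂ) * deBruijnHDiv (fun u : ℝ => 1 + u ^ 2 / a ^ 2) z) := fun z ↦ by
  have hFd : Differentiable ℂ (deBruijnHDiv fun u : ℝ => 1 + u ^ 2 / a ^ 2) :=
    differentiable_deBruijnHDiv_laplace a
  exact (hFd.deriv z).add ((hFd z).const_mul _)

/-- `G_a` is real on the real axis. [folklore] -/
theorem rayG_ofReal_im (a x : ℝ) : ((deriv (deBruijnHDiv fun u : ℝ => 1 + u ^ 2 / a ^ 2) x + (a : ℂ) * deBruijnHDiv (fun u : ℝ => 1 + u ^ 2 / a ^ 2) x)).im = 0 := by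
  have hFd : Differentiable ℂ (deBruijnHDiv fun u : ℝ => 1 + u ^ 2 / a ^ 2) :=
    differentiable_deBruijnHDiv_laplace a
  have hFreal : ∀ x : ℝ, (deBruijnHDiv (fun u : ℝ => 1 + u ^ 2 / a ^ 2) x).im = 0 :=
    fun x ↦ deBruijnHDiv_ofReal_im _ x
  simp only [Complex.add_im, Complex.mul_im, Complex.ofReal_re, Complex.ofReal_im,
    zero_mul, add_zero, im_deriv_ofReal hFd hFreal x, hFreal x, mul_zero]

/-- `G_a` has order of growth `< 2`. [folklore] -/
theorem exists_growth_rayG (a : ℝ) :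
    ∃ ρ C : ℝ, 0 ≤ ρ ∧ ρ < 2 ∧ ∀ z, ‖(deriv (deBruijnHDiv fun u : ℝ => 1 + u ^ 2 / a ^ 2) z + (a : ℂ) * deBruijnHDiv (fun u : ℝ => 1 + u ^ 2 / a ^ 2) z)‖ ≤ C * Real.exp (‖z‖ ^ ρ) := by
  obtain ⟨ρ, C, hρ0, hρ, hgr⟩ := UniversalFactor.exists_growth_deBruijnHDiv_laplace a
  obtain ⟨ρ', C', hρ'0, hρ', hgr'⟩ := UniversalFactor.exists_growth_deriv_add_mul
    (differentiable_deBruijnHDiv_laplace a) hρ0 hρ hgr (a : ℂ)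
  exact ⟨ρ', C', hρ'0, hρ', hgr'⟩

/-- The pointwise derivative of `G_a`. -/
theorem hasDerivAt_rayG (a : ℝ) (z : ℂ) :
    HasDerivAt (fun z : ℂ => deriv (deBruijnHDiv fun u : ℝ => 1 + u ^ 2 / a ^ 2) z + (a : ℂ) * deBruijnHDiv (fun u : ℝ => 1 + u ^ 2 / a ^ 2) z)
      (deriv (deriv (deBruijnHDiv fun u : ℝ => 1 + u ^ 2 / a ^ 2)) z
        + (a : ℂ) * deriv (deBruijnHDiv fun u : ℝ => 1 + u ^ 2 / a ^ 2) z) z := by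
  have hFd : Differentiable ℂ (deBruijnHDiv fun u : ℝ => 1 + u ^ 2 / a ^ 2) :=
    differentiable_deBruijnHDiv_laplace a
  have h := ((hFd.deriv z).hasDerivAt).add (((hFd z).hasDerivAt).const_mul (a : ℂ))
  exact h

/-- THE ODE: `G_a' = a G_a − a² H_0` on `ℂ` (from `F − F''/a² = H_0`). -/
theorem deriv_rayG {a : ℝ} (ha : a ≠ 0) (z : ℂ) :
    deriv (fun z : ℂ => deriv (deBruijnHDiv fun u : ℝ => 1 + u ^ 2 / a ^ 2) z + (a : ℂ) * deBruijnHDiv (fun u : ℝ => 1 + u ^ 2 / a ^ 2) z) z = (a : ℂ) * (deriv (deBruijnHDiv fun u : ℝ => 1 + u ^ 2 / a ^ 2) z + (a : ℂ) * deBruijnHDiv (fun u : ℝ => 1 + u ^ 2 / a ^ 2) z) - (a : ℂ) ^ 2 * deBruijnH 0 z := by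
  have ha0 : (a : ℂ) ≠ 0 := by exact_mod_cast ha
  rw [(hasDerivAt_rayG a z).deriv, ← deBruijnHDiv_laplace_sub_deriv_deriv a z]
  field_simp
  ring

/-- On `[0, ∞)`: `Re G_a(s) = a² · Q_a(s)`. -/
theorem re_rayG_eq_sq_mul_fwdAvg {a : ℝ} (ha : 0 < a) {s : ℝ} (hs : 0 ≤ s) :
    ((deriv (deBruijnHDiv fun u : ℝ => 1 + u ^ 2 / a ^ 2) s + (a : ℂ) * deBruijnHDiv (fun u : ℝ => 1 + u ^ 2 / a ^ 2) s)).re = a ^ 2 * (∫ y in Ioi (0 : ℝ), deBruijnH 0 ((s : ℂ) + y) * (Real.exp (-(a * y)) : ℂ)).re := by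
  have h := congrArg Complex.re (UniversalFactor.deriv_add_mul_eq_forward ha hs)
  rw [show ((a : ℂ) ^ 2) = ((a ^ 2 : ℝ) : ℂ) by push_cast; ring, Complex.re_ofReal_mul] at h
  simpa using h

/-- Laguerre's inequality for `G_a` on the real axis, GIVEN the ray. -/
theorem laguerre_rayG {a : ℝ} (ha : a ≠ 0) (h : HasOnlyRealZeros (linearFactorH a)) (s : ℝ) :
    ((deriv (deBruijnHDiv fun u : ℝ => 1 + u ^ 2 / a ^ 2) s + (a : ℂ) * deBruijnHDiv (fun u : ℝ => 1 + u ^ 2 / a ^ 2) s)).re * (deriv (deriv (fun z : ℂ => deriv (deBruijnHDiv fun u : ℝ => 1 + u ^ 2 / a ^ 2) z + (a : ℂ) * deBruijnHDiv (fun u : ℝ => 1 + u ^ 2 / a ^ 2) z)) s).re ≤ (deriv (fun z : ℂ => deriv (deBruijnHDiv fun u : ℝ => 1 + u ^ 2 / a ^ 2) z + (a : ℂ) * deBruijnHDiv (fun u : ℝ => 1 + u ^ 2 / a ^ 2) z) s).re ^ 2 := by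
  obtain ⟨ρ, C, hρ0, hρ, hgr⟩ := exists_growth_rayG a
  exact UniversalFactor.laguerre_inequality (differentiable_rayG a) hρ0 hρ hgr (rayG_ofReal_im a)
    ((hasOnlyRealZeros_rayG_iff ha).2 h) s

/-! ## The ray implies RH (it is an over-strong conjunct) -/

/-- `LinearRay a → RH` for `a > 0`: one Laguerre step `G ↦ G' − aG = −a² H_0`.  (For `a < 0` use
`linearFactorH (−a) z = linearFactorH a (−z)`-symmetry; not needed here.) -/
theorem riemannHypothesis_of_linearRay {a : ℝ} (ha : 0 < a) (h : HasOnlyRealZeros (linearFactorH a)) :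
    Summit.RiemannHypothesis := by
  have ha0 : (a : ℂ) ≠ 0 := by exact_mod_cast ha.ne'
  obtain ⟨ρ, C, hρ0, hρ, hgr⟩ := exists_growth_rayG a
  have hGz : ∀ z, (deriv (deBruijnHDiv fun u : ℝ => 1 + u ^ 2 / a ^ 2) z + (a : ℂ) * deBruijnHDiv (fun u : ℝ => 1 + u ^ 2 / a ^ 2) z) = 0 → z.im = 0 := (hasOnlyRealZeros_rayG_iff ha.ne').2 h
  have hH : ∀ z, deBruijnH 0 z = -(deriv (fun z : ℂ => deriv (deBruijnHDiv fun u : ℝ => 1 + u ^ 2 / a ^ 2) z + (a : ℂ) * deBruijnHDiv (fun u : ℝ => 1 + u ^ 2 / a ^ 2) z) z + (-(a : ℝ) : ℝ) * (deriv (deBruijnHDiv fun u : ℝ => 1 + u ^ 2 / a ^ 2) z + (a : ℂ) * deBruijnHDiv (fun u : ℝ => 1 + u ^ 2 / a ^ 2) z)) / (a : ℂ) ^ 2 := by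
    intro z
    rw [deriv_rayG ha.ne' z]
    push_cast
    field_simp
    ring
  rcases UniversalFactor.laguerre_step (differentiable_rayG a) hρ0 hρ hgr (rayG_ofReal_im a) hGz
      (-a) with hK0 | hKz
  · exfalso
    obtain ⟨z₁, hz₁⟩ := exists_deBruijnH_ne_zero 0
    exact hz₁ (by rw [hH z₁, hK0 z₁, neg_zero, zero_div])
  · refine Summit.RiemannHypothesis_iff.mpr
      (riemannHypothesis_iff_hasOnlyRealZeros_deBruijnH_zero_holds.mpr fun z hz ↦ hKz z ?_)
    have h1 := hH z
    rw [hz] at h1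
    have h2 : deriv (fun z : ℂ => deriv (deBruijnHDiv fun u : ℝ => 1 + u ^ 2 / a ^ 2) z + (a : ℂ) * deBruijnHDiv (fun u : ℝ => 1 + u ^ 2 / a ^ 2) z) z + (-(a : ℝ) : ℝ) * (deriv (deBruijnHDiv fun u : ℝ => 1 + u ^ 2 / a ^ 2) z + (a : ℂ) * deBruijnHDiv (fun u : ℝ => 1 + u ^ 2 / a ^ 2) z)
        = -((a : ℂ) ^ 2 * (-(deriv (fun z : ℂ => deriv (deBruijnHDiv fun u : ℝ => 1 + u ^ 2 / a ^ 2) z + (a : ℂ) * deBruijnHDiv (fun u : ℝ => 1 + u ^ 2 / a ^ 2) z) z + (-(a : ℝ) : ℝ) * (deriv (deBruijnHDiv fun u : ℝ => 1 + u ^ 2 / a ^ 2) z + (a : ℂ) * deBruijnHDiv (fun u : ℝ => 1 + u ^ 2 / a ^ 2) z)) / (a : ℂ) ^ 2)) := by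
      field_simp
    rw [h2, ← h1, mul_zero, neg_zero]

/-- `a ≠ 0` version via the tree's mirror symmetry `linearFactorH (−a) z = linearFactorH a (−z)`. -/
theorem riemannHypothesis_of_linearRay' {a : ℝ} (ha : a ≠ 0) (h : HasOnlyRealZeros (linearFactorH a)) :
    Summit.RiemannHypothesis := by
  rcases lt_or_gt_of_ne ha with hneg | hpos
  · have h' : HasOnlyRealZeros (linearFactorH (-a)) :=
      (Literature.Barriers.RiemannHypothesis.hasOnlyRealZeros_linearFactorH_neg_iff a).2 h
    exact riemannHypothesis_of_linearRay (neg_pos.2 hneg) h'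
  · exact riemannHypothesis_of_linearRay hpos h

/-- The barrier file's open residual `∃ a ≠ 0, HasOnlyRealZeros (linearFactorH a)` implies RH
(so it is an RH-strengthening conjunct; refuting it does not bear on RH). -/
theorem riemannHypothesis_of_exists_linearRay
    (h : ∃ a : ℝ, a ≠ 0 ∧ HasOnlyRealZeros (linearFactorH a)) : Summit.RiemannHypothesis := by
  obtain ⟨a, ha, hZ⟩ := h
  exact riemannHypothesis_of_linearRay' ha hZ

/-! ## Real-variable calculus for `u := Re G_a` on the real axis -/

/-- `u(s) := Re G_a(s)` has derivative `Re G_a'(s)`. -/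
theorem hasDerivAt_re_rayG (a s : ℝ) :
    HasDerivAt (fun t : ℝ ↦ ((deriv (deBruijnHDiv fun u : ℝ => 1 + u ^ 2 / a ^ 2) t + (a : ℂ) * deBruijnHDiv (fun u : ℝ => 1 + u ^ 2 / a ^ 2) t)).re) ((deriv (fun z : ℂ => deriv (deBruijnHDiv fun u : ℝ => 1 + u ^ 2 / a ^ 2) z + (a : ℂ) * deBruijnHDiv (fun u : ℝ => 1 + u ^ 2 / a ^ 2) z) s).re) s := by
  have h1 : HasDerivAt (fun t : ℝ ↦ (deriv (deBruijnHDiv fun u : ℝ => 1 + u ^ 2 / a ^ 2) t + (a : ℂ) * deBruijnHDiv (fun u : ℝ => 1 + u ^ 2 / a ^ 2) t)) (deriv (fun z : ℂ => deriv (deBruijnHDiv fun u : ℝ => 1 + u ^ 2 / a ^ 2) z + (a : ℂ) * deBruijnHDiv (fun u : ℝ => 1 + u ^ 2 / a ^ 2) z) s) s :=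
    ((differentiable_rayG a) s).hasDerivAt.comp_ofReal
  have h2 := (Complex.reCLM.hasFDerivAt).comp_hasDerivAt s h1
  simpa [Function.comp_def] using h2

/-- `v(s) := Re G_a'(s)` has derivative `Re G_a''(s)`. -/
theorem hasDerivAt_re_deriv_rayG (a s : ℝ) :
    HasDerivAt (fun t : ℝ ↦ (deriv (fun z : ℂ => deriv (deBruijnHDiv fun u : ℝ => 1 + u ^ 2 / a ^ 2) z + (a : ℂ) * deBruijnHDiv (fun u : ℝ => 1 + u ^ 2 / a ^ 2) z) t).re) ((deriv (deriv (fun z : ℂ => deriv (deBruijnHDiv fun u : ℝ => 1 + u ^ 2 / a ^ 2) z + (a : ℂ) * deBruijnHDiv (fun u : ℝ => 1 + u ^ 2 / a ^ 2) z)) s).re) s := by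
  have h1 : HasDerivAt (fun t : ℝ ↦ deriv (fun z : ℂ => deriv (deBruijnHDiv fun u : ℝ => 1 + u ^ 2 / a ^ 2) z + (a : ℂ) * deBruijnHDiv (fun u : ℝ => 1 + u ^ 2 / a ^ 2) z) t) (deriv (deriv (fun z : ℂ => deriv (deBruijnHDiv fun u : ℝ => 1 + u ^ 2 / a ^ 2) z + (a : ℂ) * deBruijnHDiv (fun u : ℝ => 1 + u ^ 2 / a ^ 2) z)) s) s :=
    ((differentiable_rayG a).deriv s).hasDerivAt.comp_ofReal
  have h2 := (Complex.reCLM.hasFDerivAt).comp_hasDerivAt s h1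
  simpa [Function.comp_def] using h2

/-- Real form of the ODE: `u'(s) = a u(s) − a² Re H_0(s)`. -/
theorem re_deriv_rayG {a : ℝ} (ha : a ≠ 0) (s : ℝ) :
    (deriv (fun z : ℂ => deriv (deBruijnHDiv fun u : ℝ => 1 + u ^ 2 / a ^ 2) z + (a : ℂ) * deBruijnHDiv (fun u : ℝ => 1 + u ^ 2 / a ^ 2) z) s).re = a * ((deriv (deBruijnHDiv fun u : ℝ => 1 + u ^ 2 / a ^ 2) s + (a : ℂ) * deBruijnHDiv (fun u : ℝ => 1 + u ^ 2 / a ^ 2) s)).re - a ^ 2 * (deBruijnH 0 s).re := by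
  rw [deriv_rayG ha, Complex.sub_re, Complex.re_ofReal_mul,
    show ((a : ℂ) ^ 2) = ((a ^ 2 : ℝ) : ℂ) by push_cast; ring, Complex.re_ofReal_mul]

end Summit.RiemannHypothesis.RiemannHypothesis.Theorems.Splittings.LinearRayTwoPoint

end
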